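import Literature.AlgebraicGeometry.Resolution.AffineBlowup
import Mathlib.AlgebraicGeometry.Morphisms.FiniteType
import Mathlib.AlgebraicGeometry.Noetherian
import Mathlib.Topology.JacobsonSpace
import Mathlib.RingTheory.Jacobson.Ring
import HarnessLib

/-!
# The blowing up of a finite-type affine scheme over a field is Jacobson and locally Noetherian

Support file for crux stmt-ResolutionOfSingularities-15315
(`FrobeniusLadder.FInjectiveMacaulayfication`, line `Sketch`, seat c6): stub
`stub_affineBlowupJacobsonNoetherian`.

In the tower of blowing ups of the F-injective Macaulayfication line the intermediate model
`X₁ = affineBlowup I = Bl_I(Spec R)` (`R` a finitely generated algebra over a field `k`) is the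
base of the next step, whose interface needs `IsLocallyNoetherian X₁` and closedness of the
maximal-ideal points of its charts, i.e. `JacobsonSpace X₁`.

Proof: `R` is Noetherian (`Algebra.FiniteType.isNoetherianRing k R`) and Jacobson
(`isJacobsonRing_of_finiteType`, a field being Jacobson), so `Spec R` is a Jacobson space and a
locally Noetherian scheme; the structure morphism `affineBlowup.π I : Bl_I(Spec R) ⟶ Spec R` is
proper (`affineBlowup.isProper`), in particular locally of finite type, and both properties ascend
along morphisms locally of finite type (`LocallyOfFiniteType.jacobsonSpace`,
`LocallyOfFiniteType.isLocallyNoetherian`).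

References: folklore bookkeeping over Mathlib's `JacobsonSpace` / `IsLocallyNoetherian` API and
`Literature.AlgebraicGeometry.Resolution.affineBlowup`; no definition is declared. [folklore]
-/

-- single-problem summit: the doubled namespace component `ResolutionOfSingularities` is forced
set_option linter.dupNamespace false

noncomputable section

namespace Summit.ResolutionOfSingularities.ResolutionOfSingularities.Theorems.FInjectiveMacaulayfication.AffineBlowupJacobsonNoetherian

open AlgebraicGeometry CategoryTheory Literature.AlgebraicGeometry.Resolution

/-- The source of a morphism locally of finite type to the spectrum of a Noetherian Jacobson ring
is a Jacobson space and a locally Noetherian scheme. [folklore] -/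
theorem jacobsonSpace_and_isLocallyNoetherian_of_locallyOfFiniteType {R : Type} [CommRing R]
    [IsNoetherianRing R] [IsJacobsonRing R] {X : Scheme.{0}} (f : X ⟶ Spec (.of R))
    [LocallyOfFiniteType f] : JacobsonSpace ↥X ∧ IsLocallyNoetherian X :=
  ⟨LocallyOfFiniteType.jacobsonSpace f, LocallyOfFiniteType.isLocallyNoetherian f⟩

/-- **The blowing up `Bl_I(Spec R)` of a finite-type affine `k`-scheme is a Jacobson space and
locally Noetherian.** For `R` a finitely generated algebra over a field `k` and `I` an ideal of
`R`, the blowing up `affineBlowup I = Proj R[It]` is a Jacobson topological space (closed points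
are dense in every closed subset) and a locally Noetherian scheme: both properties hold for
`Spec R` (`R` is Noetherian and Jacobson) and ascend along the proper, hence locally of finite
type, structure morphism `affineBlowup.π I`. [folklore] -/
theorem stub_affineBlowupJacobsonNoetherian : ∀ (k R : Type) [Field k] [CommRing R] [Algebra k R]
    [Algebra.FiniteType k R] (I : Ideal R),
    JacobsonSpace ↥(affineBlowup I) ∧ IsLocallyNoetherian (affineBlowup I) := by
  intro k R _ _ _ _ I
  haveI : IsNoetherianRing R := Algebra.FiniteType.isNoetherianRing k R
  haveI : IsJacobsonRing R := isJacobsonRing_of_finiteType (A := k) (B := R)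
  exact jacobsonSpace_and_isLocallyNoetherian_of_locallyOfFiniteType (affineBlowup.π I)

end Summit.ResolutionOfSingularities.ResolutionOfSingularities.Theorems.FInjectiveMacaulayfication.AffineBlowupJacobsonNoetherian

end
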